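import Mathlib.Combinatorics.SimpleGraph.Paths
import Mathlib.Combinatorics.SimpleGraph.Connectivity.Connected
import Literature.Dynamics.Tilings.TorusCNF
import Literature.Computability.MetaComplexity.ResolutionPlays
import HarnessLib

/-!
# Lifting pebbled cells of the discrete torus to the plane (toolkit for the gluing width bound)

Topic `Literature/Dynamics/Tilings`. Toolkit for `TorusCNFGluingWidth.lean` (the resolution-width
lower bound for the torus CNFs `WangTileSet.torusCNF` of tile sets admitting a strongly
irreducible family of plane tilings). A record of the Prover–Duplicator (existential pebble) game
on `torusCNF T n` mentions finitely many cells of the torus `(ℤ/n)²`; Duplicator answers from a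
plane tiling read at a LIFT of these cells to `ℤ²`. This file contains the metric bookkeeping:

* `supDist p q` — the sup-distance on `ℤ²`; `TClose g n a b` — the cells `a, b ∈ ℕ²` (read
  modulo `n`) are at torus sup-distance `≤ g`; `Cong n p c` — the plane point `p` lifts the cell `c`;
* the decoding `cellOf`, `tileOf` of the variables `torusVar t n i j s = (i·n + j)·t + s` of
  `torusCNF`, and the set `cells t n α` of cells mentioned by a record `α` (a finite set of literals);
* `GoodLift g n S L` — `L` lifts every cell of `S` (`Cong`) and lifts torus-`g`-close cells of `S`
  to `g`-close points (a "faithful" lift);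
* the `g`-proximity graph `proxGraph g n S` on the cells of `S` and the CLUSTER DIAMETER LEMMA
  `supDist_le_of_reachable`: two cells of `S` joined in the proximity graph are lifted by a good
  lift to points at sup-distance `≤ g · (|S| - 1)` (shortest paths are simple);
* the arithmetic of small representatives: a vector divisible by `n` of sup-norm `< n` vanishes
  (`eq_of_cong_of_lt`, from Mathlib's `Int.eq_zero_of_abs_lt_dvd`), whence torus-close cells in
  one cluster of a small record are lifted to their minimal displacement (`sub_eq_of_tclose`).

All statements are elementary; no published source is followed ([folklore] tags). The game and
the families are those of A. Atserias, V. Dalmau, J. Comput. Syst. Sci. 74 (2008).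
-/

namespace Literature.Dynamics.Tilings

namespace TorusGluing

open Finset Literature.Computability.Complexity

/-! ### Sup-distance on `ℤ²`, torus proximity, congruent lifts -/

/-- The sup-distance of two points of `ℤ²`. [folklore] -/
def supDist (p q : ℤ × ℤ) : ℤ := max |p.1 - q.1| |p.2 - q.2|

/-- `supDist` is symmetric. [folklore] -/
theorem supDist_comm (p q : ℤ × ℤ) : supDist p q = supDist q p := by
  unfold supDist; rw [abs_sub_comm p.1, abs_sub_comm p.2]

/-- `supDist p p = 0`. [folklore] -/
theorem supDist_self (p : ℤ × ℤ) : supDist p p = 0 := by simp [supDist]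

/-- `supDist` is nonnegative. [folklore] -/
theorem supDist_nonneg (p q : ℤ × ℤ) : 0 ≤ supDist p q :=
  le_max_of_le_left (abs_nonneg _)

/-- Triangle inequality for `supDist`. [folklore] -/
theorem supDist_triangle (p q r : ℤ × ℤ) : supDist p r ≤ supDist p q + supDist q r := by
  unfold supDist
  refine max_le ?_ ?_
  · calc |p.1 - r.1| = |(p.1 - q.1) + (q.1 - r.1)| := by ring_nf
      _ ≤ |p.1 - q.1| + |q.1 - r.1| := abs_add_le _ _
      _ ≤ _ := add_le_add (le_max_left _ _) (le_max_left _ _)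
  · calc |p.2 - r.2| = |(p.2 - q.2) + (q.2 - r.2)| := by ring_nf
      _ ≤ |p.2 - q.2| + |q.2 - r.2| := abs_add_le _ _
      _ ≤ _ := add_le_add (le_max_right _ _) (le_max_right _ _)

/-- `supDist` is translation invariant. [folklore] -/
theorem supDist_add_right (p q v : ℤ × ℤ) : supDist (p + v) (q + v) = supDist p q := by
  simp [supDist]

/-- `supDist p q ≤ g` unfolded into the two coordinates. [folklore] -/
theorem supDist_le_iff {p q : ℤ × ℤ} {g : ℤ} :
    supDist p q ≤ g ↔ |p.1 - q.1| ≤ g ∧ |p.2 - q.2| ≤ g := max_le_iff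

/-- Two cells `a, b ∈ ℕ²` of the `n × n` torus are at torus sup-distance `≤ g`: some plane
displacement of sup-norm `≤ g` is congruent to `b - a` modulo `n`. [folklore] -/
def TClose (g n : ℕ) (a b : ℕ × ℕ) : Prop :=
  ∃ d : ℤ × ℤ, |d.1| ≤ g ∧ |d.2| ≤ g ∧
    (n : ℤ) ∣ d.1 - ((b.1 : ℤ) - a.1) ∧ (n : ℤ) ∣ d.2 - ((b.2 : ℤ) - a.2)

/-- `TClose` is symmetric. [folklore] -/
theorem TClose.symm {g n : ℕ} {a b : ℕ × ℕ} (h : TClose g n a b) : TClose g n b a := by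
  obtain ⟨d, h1, h2, h3, h4⟩ := h
  refine ⟨-d, by simpa using h1, by simpa using h2, ?_, ?_⟩
  · have e : (-d).1 - ((a.1 : ℤ) - b.1) = -(d.1 - ((b.1 : ℤ) - a.1)) := by
      simp only [Prod.fst_neg]; ring
    rw [e, dvd_neg]; exact h3
  · have e : (-d).2 - ((a.2 : ℤ) - b.2) = -(d.2 - ((b.2 : ℤ) - a.2)) := by
      simp only [Prod.snd_neg]; ring
    rw [e, dvd_neg]; exact h4

/-- `TClose` is reflexive. [folklore] -/
theorem TClose.refl (g n : ℕ) (a : ℕ × ℕ) : TClose g n a a :=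
  ⟨0, by simp, by simp, by simp, by simp⟩

/-- The plane point `p` lifts the torus cell `c`: `p ≡ c` coordinatewise modulo `n`. [folklore] -/
def Cong (n : ℕ) (p : ℤ × ℤ) (c : ℕ × ℕ) : Prop :=
  (n : ℤ) ∣ p.1 - c.1 ∧ (n : ℤ) ∣ p.2 - c.2

/-- The canonical lift `(c.1, c.2)` of a cell. [folklore] -/
theorem cong_self (n : ℕ) (c : ℕ × ℕ) : Cong n ((c.1 : ℤ), (c.2 : ℤ)) c := ⟨by simp, by simp⟩

/-- Two displacements congruent modulo `n` whose difference has sup-norm `< n` are equal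
(coordinatewise `Int.eq_zero_of_abs_lt_dvd`). [folklore] -/
theorem eq_of_cong_of_lt {n : ℕ} {d d' : ℤ × ℤ}
    (h1 : (n : ℤ) ∣ d.1 - d'.1) (h2 : (n : ℤ) ∣ d.2 - d'.2)
    (hlt1 : |d.1 - d'.1| < n) (hlt2 : |d.2 - d'.2| < n) : d = d' := by
  have e1 := Int.eq_zero_of_abs_lt_dvd h1 hlt1
  have e2 := Int.eq_zero_of_abs_lt_dvd h2 hlt2
  ext <;> omega

/-- If two lifted points are `g`-close then their cells are torus-`g`-close. [folklore] -/
theorem tclose_of_cong_of_supDist_le {g n : ℕ} {a b : ℕ × ℕ} {p q : ℤ × ℤ}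
    (hp : Cong n p a) (hq : Cong n q b) (h : supDist p q ≤ g) : TClose g n a b := by
  rw [supDist_le_iff] at h
  refine ⟨q - p, ?_, ?_, ?_, ?_⟩
  · simpa [abs_sub_comm] using h.1
  · simpa [abs_sub_comm] using h.2
  · have e : (q - p).1 - ((b.1 : ℤ) - a.1) = (q.1 - b.1) - (p.1 - a.1) := by
      simp only [Prod.fst_sub]; ring
    rw [e]; exact dvd_sub hq.1 hp.1
  · have e : (q - p).2 - ((b.2 : ℤ) - a.2) = (q.2 - b.2) - (p.2 - a.2) := by
      simp only [Prod.snd_sub]; ring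
    rw [e]; exact dvd_sub hq.2 hp.2

/-- **Small representatives are forced.** If `p` lifts `a`, `q` lifts `b`, the cells are
torus-`g`-close with small displacement `d`, and `supDist p q + g < n`, then `q - p = d`: the
lift realises the minimal displacement. [folklore] -/
theorem sub_eq_of_tclose {g n : ℕ} {a b : ℕ × ℕ} {p q : ℤ × ℤ} {d : ℤ × ℤ}
    (hp : Cong n p a) (hq : Cong n q b)
    (hd1 : |d.1| ≤ g) (hd2 : |d.2| ≤ g)
    (hd3 : (n : ℤ) ∣ d.1 - ((b.1 : ℤ) - a.1)) (hd4 : (n : ℤ) ∣ d.2 - ((b.2 : ℤ) - a.2))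
    (h : supDist p q + g < n) : q - p = d := by
  have hpq := supDist_le_iff.1 (le_refl (supDist p q))
  refine eq_of_cong_of_lt (n := n) ?_ ?_ ?_ ?_
  · have e : (q - p).1 - d.1 = (q.1 - b.1) - (p.1 - a.1) - (d.1 - ((b.1 : ℤ) - a.1)) := by
      simp only [Prod.fst_sub]; ring
    rw [e]; exact dvd_sub (dvd_sub hq.1 hp.1) hd3
  · have e : (q - p).2 - d.2 = (q.2 - b.2) - (p.2 - a.2) - (d.2 - ((b.2 : ℤ) - a.2)) := by
      simp only [Prod.snd_sub]; ring
    rw [e]; exact dvd_sub (dvd_sub hq.2 hp.2) hd4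
  · calc |(q - p).1 - d.1| ≤ |(q - p).1| + |d.1| := abs_sub _ _
      _ = |p.1 - q.1| + |d.1| := by simp [abs_sub_comm]
      _ < n := by linarith [hpq.1]
  · calc |(q - p).2 - d.2| ≤ |(q - p).2| + |d.2| := abs_sub _ _
      _ = |p.2 - q.2| + |d.2| := by simp [abs_sub_comm]
      _ < n := by linarith [hpq.2]

/-! ### Decoding the variables of the torus CNF -/

/-- The cell `(i, j)` of the variable `(i·n + j)·t + s`. [folklore] -/
def cellOf (t n : ℕ) (x : ℕ) : ℕ × ℕ := (x / t / n, x / t % n)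

/-- The tile `s` of the variable `(i·n + j)·t + s`. [folklore] -/
def tileOf (t : ℕ) (x : ℕ) : ℕ := x % t

/-- Decoding the cell of `torusVar t n i j s`. [folklore] -/
theorem cellOf_torusVar {t n : ℕ} (i j : Fin n) (s : Fin t) :
    cellOf t n (WangTileSet.torusVar t n i j s) = (i.1, j.1) := by
  have ht : 0 < t := lt_of_le_of_lt (Nat.zero_le _) s.2
  have hn : 0 < n := lt_of_le_of_lt (Nat.zero_le _) j.2
  unfold cellOf WangTileSet.torusVar
  have h1 : ((i.1 * n + j.1) * t + s.1) / t = i.1 * n + j.1 := by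
    rw [Nat.add_comm, Nat.add_mul_div_right _ _ ht, Nat.div_eq_of_lt s.2, Nat.zero_add]
  rw [h1]
  have h2 : (i.1 * n + j.1) / n = i.1 := by
    rw [Nat.add_comm, Nat.add_mul_div_right _ _ hn, Nat.div_eq_of_lt j.2, Nat.zero_add]
  have h3 : (i.1 * n + j.1) % n = j.1 := by
    rw [Nat.add_comm, Nat.add_mul_mod_self_right, Nat.mod_eq_of_lt j.2]
  rw [h2, h3]

/-- Decoding the tile of `torusVar t n i j s`. [folklore] -/
theorem tileOf_torusVar {t n : ℕ} (i j : Fin n) (s : Fin t) :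
    tileOf t (WangTileSet.torusVar t n i j s) = s.1 := by
  unfold tileOf WangTileSet.torusVar
  rw [Nat.add_comm, Nat.add_mul_mod_self_right, Nat.mod_eq_of_lt s.2]

/-- The variables of the torus CNF are `< n·n·t`. [folklore] -/
theorem torusVar_lt {t n : ℕ} (i j : Fin n) (s : Fin t) :
    WangTileSet.torusVar t n i j s < n * n * t := by
  unfold WangTileSet.torusVar
  have h1 : i.1 * n + j.1 < n * n := by
    calc i.1 * n + j.1 < i.1 * n + n := Nat.add_lt_add_left j.2 _
      _ = (i.1 + 1) * n := by ring
      _ ≤ n * n := Nat.mul_le_mul_right _ (Nat.succ_le_of_lt i.2)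
  calc (i.1 * n + j.1) * t + s.1 < (i.1 * n + j.1) * t + t := Nat.add_lt_add_left s.2 _
    _ = (i.1 * n + j.1 + 1) * t := by ring
    _ ≤ n * n * t := Nat.mul_le_mul_right _ (Nat.succ_le_of_lt h1)

/-- The coordinates of a decoded in-range variable are `< n`. [folklore] -/
theorem cellOf_lt {t n x : ℕ} (hx : x < n * n * t) :
    (cellOf t n x).1 < n ∧ (cellOf t n x).2 < n := by
  have ht : 0 < t := Nat.pos_of_ne_zero fun h => by subst h; simp at hx
  have hn : 0 < n := Nat.pos_of_ne_zero fun h => by subst h; simp at hx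
  refine ⟨?_, Nat.mod_lt _ hn⟩
  unfold cellOf
  rw [Nat.div_lt_iff_lt_mul hn, Nat.div_lt_iff_lt_mul ht]
  simpa [Nat.mul_comm, Nat.mul_assoc, Nat.mul_left_comm] using hx

/-- The tile of an in-range variable is `< t`. [folklore] -/
theorem tileOf_lt {t x : ℕ} (ht : 0 < t) : tileOf t x < t := Nat.mod_lt _ ht

/-- The cells mentioned by a record: the cells of its in-range literals. [folklore] -/
def cells (t n : ℕ) (α : Finset (Literal ℕ)) : Finset (ℕ × ℕ) :=
  (α.filter fun l => l.1 < n * n * t).image fun l => cellOf t n l.1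

/-- The cell of an in-range literal of `α` is a cell of `α`. [folklore] -/
theorem mem_cells_of_mem {t n : ℕ} {α : Finset (Literal ℕ)} {l : Literal ℕ} (hl : l ∈ α)
    (hx : l.1 < n * n * t) : cellOf t n l.1 ∈ cells t n α :=
  Finset.mem_image.2 ⟨l, Finset.mem_filter.2 ⟨hl, hx⟩, rfl⟩

/-- Membership in `cells`. [folklore] -/
theorem mem_cells_iff {t n : ℕ} {α : Finset (Literal ℕ)} {c : ℕ × ℕ} :
    c ∈ cells t n α ↔ ∃ l ∈ α, l.1 < n * n * t ∧ cellOf t n l.1 = c := by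
  simp only [cells, Finset.mem_image, Finset.mem_filter, and_assoc]

/-- `cells` is monotone. [folklore] -/
theorem cells_mono {t n : ℕ} {α β : Finset (Literal ℕ)} (h : β ⊆ α) : cells t n β ⊆ cells t n α :=
  Finset.image_subset_image (Finset.filter_subset_filter _ h)

/-- A record mentions at most as many cells as it has literals. [folklore] -/
theorem card_cells_le {t n : ℕ} (α : Finset (Literal ℕ)) : (cells t n α).card ≤ α.card :=
  Finset.card_image_le.trans (Finset.card_filter_le _ _)

/-- Adding an out-of-range literal does not change the cells. [folklore] -/
theorem cells_insert_of_le {t n : ℕ} (α : Finset (Literal ℕ)) {l : Literal ℕ} (hl : n * n * t ≤ l.1) :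
    cells t n (insert l α) = cells t n α := by
  unfold cells
  rw [Finset.filter_insert, if_neg (not_lt.2 hl)]

/-- Adding an in-range literal adds its cell. [folklore] -/
theorem cells_insert_of_lt {t n : ℕ} (α : Finset (Literal ℕ)) {l : Literal ℕ} (hl : l.1 < n * n * t) :
    cells t n (insert l α) = insert (cellOf t n l.1) (cells t n α) := by
  unfold cells
  rw [Finset.filter_insert, if_pos hl, Finset.image_insert]

/-- The cells of a record have coordinates `< n`. [folklore] -/
theorem lt_of_mem_cells {t n : ℕ} {α : Finset (Literal ℕ)} {c : ℕ × ℕ} (hc : c ∈ cells t n α) :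
    c.1 < n ∧ c.2 < n := by
  obtain ⟨l, -, hl, rfl⟩ := mem_cells_iff.1 hc
  exact cellOf_lt hl

/-! ### Good lifts -/

/-- A **good lift** of a set `S` of cells: `L` lifts every cell of `S` to a congruent point of the
plane, and torus-`g`-close cells of `S` to `g`-close points. [folklore] -/
structure GoodLift (g n : ℕ) (S : Finset (ℕ × ℕ)) (L : ℕ × ℕ → ℤ × ℤ) : Prop where
  /-- every cell is lifted to a congruent point -/
  cong : ∀ c ∈ S, Cong n (L c) c
  /-- torus-`g`-close cells are lifted to `g`-close points -/
  close : ∀ a ∈ S, ∀ b ∈ S, TClose g n a b → supDist (L a) (L b) ≤ g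

/-- Good lifts restrict to subsets. [folklore] -/
theorem GoodLift.mono {g n : ℕ} {S S' : Finset (ℕ × ℕ)} {L : ℕ × ℕ → ℤ × ℤ} (h : GoodLift g n S L)
    (hS : S' ⊆ S) : GoodLift g n S' L :=
  ⟨fun c hc => h.cong c (hS hc), fun a ha b hb => h.close a (hS ha) b (hS hb)⟩

/-- The empty set of cells has a good lift. [folklore] -/
theorem goodLift_empty (g n : ℕ) (L : ℕ × ℕ → ℤ × ℤ) : GoodLift g n ∅ L :=
  ⟨fun _ h => absurd h (Finset.notMem_empty _), fun _ h => absurd h (Finset.notMem_empty _)⟩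

/-- **Adjacent cells are lifted to adjacent points.** Under a good lift with `g + 1 < n` and
`1 ≤ g`, two cells of `S` whose difference is congruent to a unit (or any sup-norm-`≤ 1`) vector
`e` are lifted to points differing by exactly `e`. [folklore] -/
theorem GoodLift.sub_eq_of_unit {g n : ℕ} {S : Finset (ℕ × ℕ)} {L : ℕ × ℕ → ℤ × ℤ}
    (h : GoodLift g n S L) (hg : 1 ≤ g) (hgn : g + 1 < n) {a b : ℕ × ℕ} (ha : a ∈ S) (hb : b ∈ S)
    {e : ℤ × ℤ} (he1 : |e.1| ≤ 1) (he2 : |e.2| ≤ 1)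
    (hc1 : (n : ℤ) ∣ e.1 - ((b.1 : ℤ) - a.1)) (hc2 : (n : ℤ) ∣ e.2 - ((b.2 : ℤ) - a.2)) :
    L b - L a = e := by
  have hg' : (1 : ℤ) ≤ g := by exact_mod_cast hg
  have hclose : TClose g n a b := ⟨e, he1.trans hg', he2.trans hg', hc1, hc2⟩
  have hd := h.close a ha b hb hclose
  refine sub_eq_of_tclose (g := 1) (h.cong a ha) (h.cong b hb) he1 he2 hc1 hc2 ?_
  have : (g : ℤ) + 1 < n := by exact_mod_cast hgn
  push_cast
  linarith

/-! ### The proximity graph on a set of cells and the cluster diameter lemma -/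

/-- The `g`-proximity graph on the cells of `S`: distinct torus-`g`-close cells of `S` are
adjacent (cells outside `S` are isolated). Its connected components meeting `S` are the
CLUSTERS of `S`. [folklore] -/
def proxGraph (g n : ℕ) (S : Finset (ℕ × ℕ)) : SimpleGraph (ℕ × ℕ) where
  Adj a b := a ≠ b ∧ a ∈ S ∧ b ∈ S ∧ TClose g n a b
  symm := ⟨fun _ _ ⟨hne, ha, hb, hc⟩ => ⟨hne.symm, hb, ha, hc.symm⟩⟩
  loopless := ⟨fun _ h => h.1 rfl⟩

/-- The proximity graph is monotone in `S`. [folklore] -/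
theorem proxGraph_mono {g n : ℕ} {S S' : Finset (ℕ × ℕ)} (h : S' ⊆ S) :
    proxGraph g n S' ≤ proxGraph g n S :=
  fun _ _ ⟨hne, ha, hb, hc⟩ => ⟨hne, h ha, h hb, hc⟩

/-- Reachability in the proximity graph is monotone in `S`. [folklore] -/
theorem reachable_mono {g n : ℕ} {S S' : Finset (ℕ × ℕ)} (h : S' ⊆ S) {a b : ℕ × ℕ}
    (hab : (proxGraph g n S').Reachable a b) : (proxGraph g n S).Reachable a b :=
  hab.mono (proxGraph_mono h)

/-- The vertices of a walk starting in `S` all lie in `S`. [folklore] -/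
theorem support_subset {g n : ℕ} {S : Finset (ℕ × ℕ)} {a b : ℕ × ℕ}
    (p : (proxGraph g n S).Walk a b) (ha : a ∈ S) : ∀ c ∈ p.support, c ∈ S := by
  induction p with
  | nil => intro c hc; simp at hc; subst hc; exact ha
  | cons hadj q ih =>
    intro c hc
    rw [SimpleGraph.Walk.support_cons, List.mem_cons] at hc
    rcases hc with rfl | hc
    · exact ha
    · exact ih hadj.2.2.1 c hc

/-- The endpoint of a walk starting in `S` lies in `S`. [folklore] -/
theorem mem_of_reachable {g n : ℕ} {S : Finset (ℕ × ℕ)} {a b : ℕ × ℕ}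
    (hab : (proxGraph g n S).Reachable a b) (ha : a ∈ S) : b ∈ S := by
  obtain ⟨p⟩ := hab
  exact support_subset p ha b p.end_mem_support

/-- Along a walk of length `m` a good lift moves by at most `g · m` in sup-distance. [folklore] -/
theorem supDist_le_length {g n : ℕ} {S : Finset (ℕ × ℕ)} {L : ℕ × ℕ → ℤ × ℤ}
    (hL : GoodLift g n S L) {a b : ℕ × ℕ} (p : (proxGraph g n S).Walk a b) :
    supDist (L a) (L b) ≤ g * p.length := by
  induction p with
  | nil => simp [supDist_self]
  | cons hadj q ih =>
    rename_i u v w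
    have h1 : supDist (L u) (L v) ≤ g := hL.close u hadj.2.1 v hadj.2.2.1 hadj.2.2.2
    calc supDist (L u) (L w) ≤ supDist (L u) (L v) + supDist (L v) (L w) := supDist_triangle _ _ _
      _ ≤ g + g * q.length := add_le_add h1 ih
      _ = g * (SimpleGraph.Walk.cons hadj q).length := by
          rw [SimpleGraph.Walk.length_cons]; push_cast; ring

/-- A path in the proximity graph starting in `S` has fewer than `|S|` edges. [folklore] -/
theorem length_lt_card_of_isPath {g n : ℕ} {S : Finset (ℕ × ℕ)} {a b : ℕ × ℕ}
    (p : (proxGraph g n S).Walk a b) (hp : p.IsPath) (ha : a ∈ S) : p.length < S.card := by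
  have hnd : p.support.Nodup := hp.support_nodup
  have hsub : p.support.toFinset ⊆ S := fun c hc => support_subset p ha c (List.mem_toFinset.1 hc)
  have h1 : p.support.toFinset.card = p.support.length := List.toFinset_card_of_nodup hnd
  have h2 := Finset.card_le_card hsub
  rw [h1, SimpleGraph.Walk.length_support] at h2
  omega

/-- **Cluster diameter lemma.** Two cells of `S` in the same cluster (joined in the
`g`-proximity graph) are lifted by a good lift to points at sup-distance `≤ g · (|S| - 1)`.
[folklore] -/
theorem supDist_le_of_reachable {g n : ℕ} {S : Finset (ℕ × ℕ)} {L : ℕ × ℕ → ℤ × ℤ}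
    (hL : GoodLift g n S L) {a b : ℕ × ℕ} (ha : a ∈ S)
    (hab : (proxGraph g n S).Reachable a b) : supDist (L a) (L b) ≤ g * (S.card - 1 : ℤ) := by
  classical
  obtain ⟨p⟩ := hab
  have hpath := p.bypass_isPath
  have hlen := length_lt_card_of_isPath p.bypass hpath ha
  calc supDist (L a) (L b) ≤ g * (p.bypass.length : ℤ) := supDist_le_length hL p.bypass
    _ ≤ g * (S.card - 1 : ℤ) := by
        apply mul_le_mul_of_nonneg_left _ (by positivity)
        have : (p.bypass.length : ℤ) + 1 ≤ S.card := by exact_mod_cast hlen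
        linarith

end TorusGluing

end Literature.Dynamics.Tilings
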